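import Summits.QuantumFields.YangMills.Theorems.BalabanUVNodesN16H7TightWindow
import HarnessLib

/-!
# Route «BalabanUVNodes» (K3⁷ `SpineGivenEndpointR13SepCoPH`, stmt-QuantumFields-20544), DAG node N16 = NE3 — THE N07 → N16 EDGE `h7`, THE TIGHT-WINDOW
# RESIDUE IN VALUE FORM: `stub_h7` ⇐ [B11] THEOREM 1 AT THE TORUS INSTANCES ∧ «NO-BINDING» (inflating the class radius `ε ↦ (1+4B₃)ε` does not lower the
# constrained minimal action at tight data); and the DICHOTOMY that Theorem 1 alone yields at every datum

Cell `pub-ymgap`, width seat `pub-ymgap-dag-n16-w1` (director-ym №197 ∕ HUMAN RULING D-0149), generation 2, file 4 — over this lineage's files 1–2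
(`BalabanUVNodesN16H7OfReg9` p584527, `BalabanUVNodesN16H7TightWindow` p586490) and their LOCATED note (evidence #9∕#14 on stmt-QuantumFields-20544,
`HOME/pub-ymgap-dag-n16-w1/LOCATED-N16-H7-PRINT-GAP.md`).  `--kind proof --supports stmt-QuantumFields-20544 --as helper` (count-neutral).  `bears_on: R4∕N16 · edge N07 → N16`.

THE POINT.  File 2 decomposed dag-n16-e's `stub_h7` (evidence #6) EXACTLY into [Balaban1985Variational] Theorem 1 read at leaf-06's torus instances
(`hT : ∀ k, B11Thm1.Thm1At C (MinimalActionDictionary.torusVP d L N G (k+1))`, covering the LOOSE data `V ∈ sfClass d L N (ε∕B₃) 0`) and the TIGHT-WINDOW LEAF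
AP-N16-2 — a REGULARITY-type statement ((10)-type flux-gradient bounds) about minimisers of run `k+1` over the plaquette ball `sfClass d L N ε` whose datum has
(7)-size in `]ε∕B₃, 4ε]`, i.e. minimisers constrained in a ball SMALLER than print's (8) — about which Theorem 1 p. 279 says nothing.  THIS FILE replaces that
regularity-type residue by a VALUE-type one.  Two kernel facts: (i) for NESTED classes `sfClass ε ⊆ sfClass ε′` and one datum, `A_{k+1}^{ε′}(V) ≤ A_{k+1}^{ε}(V)`,
with equality iff every `ε`-minimiser is an `ε′`-minimiser (§2 — elementary); (ii) at the INFLATED radius `ε′ = (1+4B₃)ε` every datum carrying an `ε`-minimiser is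
LOOSE: `V ∈ sfClass d L N (4ε) 0 ⊆ sfClass d L N (ε′∕B₃) 0` ([Balaban1985Averaging] Prop. 2, PROVED in the tree — file 2 §1 plus unitarity∕periodicity of the averages,
§1 here).  So the SAME displayed hypothesis `hT`, invoked at `ε₁ = ε′∕B₃`, gives (8) an `ε′`-minimiser and (9)–(10) for ALL `ε′`-minimisers (file 1 §3 at `ε′`),
whence the DICHOTOMY (§5, from `hT` alone): at every datum carrying an `ε`-minimiser `U`, EITHER `A^{ε}(V) = A^{ε′}(V)` and `U` is (9)–(10)-regular with the linear
letters `16937·(1+4B₃)·ε`, OR `A^{ε′}(V) < A^{ε}(V)` — the radius-`ε` plaquette constraint BINDS IN ENERGY, every print-minimal configuration at radius `ε′` has LEFT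
the tree's ball (§5, escape form), and print is silent.  Consequently (§4) `stub_h7` ⇐ `hT` ∧ NO-BINDING, where NO-BINDING := «for `0 < ε ≤ a` and tight data
`V ∉ sfClass (ε∕B₃) 0` carrying an `ε`-minimiser of run `k+1`: `minAct (sfClass ε) (k+1) V ≤ minAct (sfClass ((1+4B₃)ε)) (k+1) V`» — a statement about MINIMAL
VALUES only (no gauges, no gradients), provable or refutable by energy comparison (quadratic abelian model, constant-curvature data: it holds — the
constant-curvature competitor is minimal in every ball containing it; general data: a maximum-principle-type question «sup|F(U_min)| ≤ ε η²» for the constrained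
minimiser of the inflated problem, NOT in print; where it fails the tree's `ε`-minimisers have active plaquette constraints).

WHAT THIS FILE PROVES (kernel, theorems only, 0 `def`, 0 sorry; BY NAME over landed modules).  §1 `isPeriodicCfg_avgIter`, **`datum_mem_sfClass_of_isMinimiser`**
(an `ε`-minimiser of run `k+1` has datum `V ∈ sfClass d L N (4ε) 0`; [B7] Prop. 2 BY NAME).  §2 nested classes `𝒞 k ⊆ 𝒞′ k`, one datum: `admissible_mono`,
`isMinimiser_of_inflate_of_mem`, `minAct_inflate_le` (`A′ ≤ A`), **`isMinimiser_inflate_of_minAct_le`** (`A ≤ A′` ⟹ every small-class minimiser is an inflated-class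
minimiser), `isMinimiser_inflate_iff_minAct_le`, `isMinimiser_inflate_of_capture` (CAPTURE form), `not_mem_of_minAct_lt` (ESCAPE form).  §3 **`leafH3sup_of_inflate_of_noBinding`**
(radii `ε ≤ ε′`: the leaf (H3ˢᵘᵖ) at radius `ε′` ∧ no-binding ⟹ the leaf at radius `ε`, same letters).  §4 ★ **`tightLeaf_of_thm1At_torusVP_of_noBinding`** (EXACTLY
file 2's displayed `htight` ⟸ `hT` ∧ NO-BINDING; `Ct = 16937(1+4B₃)`), ★ **`h7Shape_of_thm1At_torusVP_of_noBinding`** (the `∃ C ε₀` shape of `stub_h7` on ALL of `dom`),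
★ **`h7_at_record_of_thm1At_of_noBinding`** (d = 4, `L = F.L`, `ne3NperOfRecord₁₁ F 0 0`, `ne3DomOfRecord₁₁ F N 0 0`: LITERALLY `stub_h7`'s statement ⟸ Theorem 1 at the
record's torus instances ∧ NO-BINDING-at-record).  §5 `minAct_inflate_le_of_thm1At_torusVP` (`A^{ε′} ≤ A^{ε}` always — NO-BINDING is the EQUALITY),
★ **`regularSup_or_minAct_lt_of_thm1At_torusVP`** (THE DICHOTOMY), **`regularSup_or_escape_of_thm1At_torusVP`** (escape form).

HONEST FRAMING.  Elementary variational logic + bookkeeping over landed theorems BY NAME ([B7] Prop. 2 is PROVED in the tree; [B11] Thm 1 = the displayed hypothesis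
`Thm1At` for leaf-06's instances, divergences D-s3-1…6, the located item AP-N16-1 inside; NO-BINDING = displayed hypothesis, NOT in print, asserted for nothing — it
REPLACES AP-N16-2, it does not prove it); `stub_h7` NOT closed; N16 ∕ N07 ∕ NE3 NOT discharged; count-neutral; counts of record unmoved (typed 28∕28 · discharged 5∕27);
one finite four-torus at fixed `ε`, Bałaban AS PRINTED — NOT ℝ⁴, NOT infinite volume, NOT OS, NOT a mass gap; the YM mass gap (Clay) is NOT proved by any of this — R4
closes the conditional finite-𝕋⁴ rung `BalabanLadder.UV` only.
-/

set_option autoImplicit false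

open scoped BigOperators Matrix Matrix.Norms.L2Operator
open NormedSpace

namespace Summit.QuantumFields.YangMills.BalabanUVNodes.N16H7NoBinding

open Literature.MathematicalPhysics.QuantumFieldTheory.Balaban1983to89
open B7Prop1Explicit B7Prop2Explicit MatrixLog UnitaryModel
open T4AveragingDeficitWall hiding Site Plane Plaq Bond
open T4AveragingDeficitWallBoundary (IsPeriodicCfg)
open T4Continuum (T4Family)
open Summit.QuantumFields.BalabanUV.T4Continuum
open AveragingDeficitLatticeH2Prep (fd)
open MinimalActionSandwich (IsMinimiser admissible minAct)
open MinimalActionLevels (isPeriodicCfg_rescale_bavg)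
open MinimalActionRate (sfClass)
open MinimalActionRefine (RegularSup)
open MinimalActionDictionary (torusVP RadiiMono sfClass_mono)
open NE3.LeafIndexSockets (LeafH3sup)
open B11Thm1 (Thm1At)
open Node00 (ne3NperOfRecord₁₁ ne3DomOfRecord₁₁ MatA)
open Summit.QuantumFields.YangMills.BalabanUVNodes.N16H7OfReg9 (leafH3sup_mono leafH3sup_loose_of_thm1At_torusVP)
open Summit.QuantumFields.YangMills.BalabanUVNodes.N16H7TightWindow (pdev_le_of_mem_sfClass smallField_datum_of_isMinimiser
  h7Shape_of_thm1At_torusVP_of_tightLeaf)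

noncomputable section

variable {d : ℕ} {n : Type} [Fintype n] [DecidableEq n]

/-! ## §1 The datum of a minimiser is a loose datum for the inflated radius -/

/-- The `j`-fold average (43) of an `(Lʲ·P)`-periodic configuration is `P`-periodic (induction on `j` over `MinimalActionLevels.isPeriodicCfg_rescale_bavg`).
[cite: Balaban1985Averaging, (43) p.24] -/
theorem isPeriodicCfg_avgIter (L : ℕ) :
    ∀ (j : ℕ) {P : ℤ} {U : Site d → Fin d → (Matrix n n ℂ)ˣ}, IsPeriodicCfg U ((L : ℤ) ^ j * P) → IsPeriodicCfg (avgIter L U j) P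
  | 0, P, U, hU => by simpa using hU
  | j + 1, P, U, hU => by
    rw [avgIter_succ]
    refine isPeriodicCfg_rescale_bavg L (isPeriodicCfg_avgIter L j ?_)
    have h : (L : ℤ) ^ j * ((L : ℤ) * P) = (L : ℤ) ^ (j + 1) * P := by ring
    rw [h]; exact hU

/-- **THE DATUM OF AN `ε`-MINIMISER IS A LOOSE DATUM FOR EVERY RADIUS `≥ 4B₃ε`**: if `U` minimises run `k+1` over `sfClass d L N ε` with datum `V`
(`L ≥ 2`, `0 < ε`, `C₀(d)·2ε ≤ ⅓`, `4ε ≤ c₂′(d,L)`), then `V ∈ sfClass d L N (4ε) 0` — unitary ([Balaban1985Averaging] Prop. 2, averages of unitary small fields are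
unitary: `B7Prop2Explicit.prop2_unitaryUnits`), `N`-periodic (`isPeriodicCfg_avgIter`), and `4ε`-small (file 2's `smallField_datum_of_isMinimiser`, Prop. 2 (54)).
[cite: Balaban1985Averaging, Prop. 2 (52)–(54) p.26] -/
theorem datum_mem_sfClass_of_isMinimiser [Nonempty n] {L N : ℕ} (hL : 2 ≤ L) {ε : ℝ} (hε : 0 < ε) (hε3 : C0 d * (2 * ε) ≤ 1 / 3)
    (hε2 : 2 * (2 * ε) ≤ c2' d L) {k : ℕ} {V U : Site d → Fin d → (Matrix n n ℂ)ˣ} (hU : IsMinimiser d (sfClass d L N ε) L N (k + 1) V U) :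
    V ∈ sfClass d L N (4 * ε) 0 := by
  letI : CStarAlgebra (Matrix n n ℂ) := {}
  have hmem : U ∈ sfClass d L N ε (k + 1) := hU.mem.1
  have havg : avgIter L U (k + 1) = V := hU.mem.2
  obtain ⟨hu, hp, -⟩ := hU.mem.1
  have hL0 : (0 : ℝ) < L := by exact_mod_cast (by omega : 0 < L)
  have hLk : (0 : ℝ) < ((L : ℝ) ^ (k + 1)) ^ 2 := by positivity
  have hpdev : pdev U < 2 * ε * (((L : ℝ) ^ (k + 1))⁻¹) ^ 2 := by
    have hle := pdev_le_of_mem_sfClass hε.le hmem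
    rw [inv_pow, ← div_eq_mul_inv]
    exact hle.trans_lt (div_lt_div_of_pos_right (by linarith) hLk)
  have hα : (0 : ℝ) < 2 * ε := by linarith
  have hunit := (prop2_unitaryUnits L hL (k + 1) U hu hα hε3 hε2 hpdev).2 (k + 1) le_rfl
  rw [havg] at hunit
  refine ⟨fun x κ => hunit x κ, ?_, ?_⟩
  · have hp' : IsPeriodicCfg U ((L : ℤ) ^ (k + 1) * ((N * L ^ 0 : ℕ) : ℤ)) := by
      have h : (L : ℤ) ^ (k + 1) * ((N * L ^ 0 : ℕ) : ℤ) = ((N * L ^ (k + 1) : ℕ) : ℤ) := by push_cast; ring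
      rw [h]; exact hp
    have hper := isPeriodicCfg_avgIter L (k + 1) hp'
    rwa [havg] at hper
  · have h := smallField_datum_of_isMinimiser hL hε hε3 hε2 hU
    simpa using h

/-! ## §2 Nested classes, one datum: minimal values and minimisers -/

/-- Admissible sets are monotone in the class. [folklore] -/
theorem admissible_mono {𝒞 𝒞' : ℕ → Set (Site d → Fin d → (Matrix n n ℂ)ˣ)} {L k : ℕ} (h : 𝒞 k ⊆ 𝒞' k)
    (V : Site d → Fin d → (Matrix n n ℂ)ˣ) : admissible 𝒞 L k V ⊆ admissible 𝒞' L k V :=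
  fun _ hU => ⟨h hU.1, hU.2⟩

/-- A minimiser over the INFLATED class `𝒞′` which lies in the small class `𝒞 k` is a minimiser over `𝒞`. [folklore] -/
theorem isMinimiser_of_inflate_of_mem {𝒞 𝒞' : ℕ → Set (Site d → Fin d → (Matrix n n ℂ)ˣ)} {L N k : ℕ}
    {V U' : Site d → Fin d → (Matrix n n ℂ)ˣ} (h : 𝒞 k ⊆ 𝒞' k) (hU' : IsMinimiser d 𝒞' L N k V U') (hmem : U' ∈ 𝒞 k) :
    IsMinimiser d 𝒞 L N k V U' :=
  ⟨⟨hmem, hU'.mem.2⟩, fun W hW => hU'.le W (admissible_mono h V hW)⟩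

/-- The minimal action is ANTITONE in the class: `A′ ≤ A` (given a minimiser on each side, so that both infima are attained). [folklore] -/
theorem minAct_inflate_le {𝒞 𝒞' : ℕ → Set (Site d → Fin d → (Matrix n n ℂ)ˣ)} {L N k : ℕ}
    {V U U' : Site d → Fin d → (Matrix n n ℂ)ˣ} (h : 𝒞 k ⊆ 𝒞' k) (hU : IsMinimiser d 𝒞 L N k V U) (hU' : IsMinimiser d 𝒞' L N k V U') :
    minAct d 𝒞' L N k V ≤ minAct d 𝒞 L N k V := by
  rw [hU.minAct_eq]
  exact hU'.minAct_le (admissible_mono h V hU.mem)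

/-- **IF INFLATING THE CLASS DOES NOT LOWER THE MINIMAL ACTION, EVERY SMALL-CLASS MINIMISER IS AN INFLATED-CLASS MINIMISER** (`A ≤ A′`, an inflated-class
minimiser existing). [folklore] -/
theorem isMinimiser_inflate_of_minAct_le {𝒞 𝒞' : ℕ → Set (Site d → Fin d → (Matrix n n ℂ)ˣ)} {L N k : ℕ}
    {V U U' : Site d → Fin d → (Matrix n n ℂ)ˣ} (h : 𝒞 k ⊆ 𝒞' k) (hU : IsMinimiser d 𝒞 L N k V U) (hU' : IsMinimiser d 𝒞' L N k V U')
    (hle : minAct d 𝒞 L N k V ≤ minAct d 𝒞' L N k V) : IsMinimiser d 𝒞' L N k V U :=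
  ⟨admissible_mono h V hU.mem, fun W hW => by
    rw [← hU.minAct_eq]
    exact hle.trans (hU'.minAct_le hW)⟩

/-- The exact criterion: a small-class minimiser is an inflated-class minimiser iff `A ≤ A′` (iff `A = A′`, by `minAct_inflate_le`). [folklore] -/
theorem isMinimiser_inflate_iff_minAct_le {𝒞 𝒞' : ℕ → Set (Site d → Fin d → (Matrix n n ℂ)ˣ)} {L N k : ℕ}
    {V U U' : Site d → Fin d → (Matrix n n ℂ)ˣ} (h : 𝒞 k ⊆ 𝒞' k) (hU : IsMinimiser d 𝒞 L N k V U) (hU' : IsMinimiser d 𝒞' L N k V U') :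
    IsMinimiser d 𝒞' L N k V U ↔ minAct d 𝒞 L N k V ≤ minAct d 𝒞' L N k V :=
  ⟨fun h' => le_of_eq (by rw [hU.minAct_eq, h'.minAct_eq]), fun hle => isMinimiser_inflate_of_minAct_le h hU hU' hle⟩

/-- CAPTURE form: if SOME inflated-class minimiser lies in the small class, then `A = A′` and EVERY small-class minimiser is an inflated-class minimiser. [folklore] -/
theorem isMinimiser_inflate_of_capture {𝒞 𝒞' : ℕ → Set (Site d → Fin d → (Matrix n n ℂ)ˣ)} {L N k : ℕ}
    {V U U' : Site d → Fin d → (Matrix n n ℂ)ˣ} (h : 𝒞 k ⊆ 𝒞' k) (hU : IsMinimiser d 𝒞 L N k V U) (hU' : IsMinimiser d 𝒞' L N k V U')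
    (hmem : U' ∈ 𝒞 k) : IsMinimiser d 𝒞' L N k V U := by
  refine isMinimiser_inflate_of_minAct_le h hU hU' ?_
  rw [hU'.minAct_eq, ← (isMinimiser_of_inflate_of_mem h hU' hmem).minAct_eq]

/-- ESCAPE form (contrapositive of capture): if inflating the class STRICTLY lowers the minimal action, NO inflated-class minimiser lies in the small class —
every one of them has left `𝒞 k`. [folklore] -/
theorem not_mem_of_minAct_lt {𝒞 𝒞' : ℕ → Set (Site d → Fin d → (Matrix n n ℂ)ˣ)} {L N k : ℕ}
    {V U' : Site d → Fin d → (Matrix n n ℂ)ˣ} (h : 𝒞 k ⊆ 𝒞' k) (hU' : IsMinimiser d 𝒞' L N k V U')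
    (hlt : minAct d 𝒞' L N k V < minAct d 𝒞 L N k V) : U' ∉ 𝒞 k := fun hmem =>
  absurd (le_of_eq (by rw [(isMinimiser_of_inflate_of_mem h hU' hmem).minAct_eq, hU'.minAct_eq]) :
    minAct d 𝒞 L N k V ≤ minAct d 𝒞' L N k V) (not_le.mpr hlt)

/-! ## §3 The leaf (H3ˢᵘᵖ) transferred DOWN the class radius under no-binding -/

/-- **THE LEAF AT CLASS RADIUS `ε` FROM THE LEAF AT AN INFLATED RADIUS `ε′ ≥ ε` AND NO-BINDING.**  If every minimiser of run `k+1` over `sfClass d L N ε′` with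
datum in `D′` is `RegularSup … b c (k+1)`, and every `ε`-minimiser `U` with datum `V ∈ D` has `V ∈ D′`, an `ε′`-minimiser at `(V, k+1)`, and
`A^{ε}_{k+1}(V) ≤ A^{ε′}_{k+1}(V)`, then every such `U` is an `ε′`-minimiser (`isMinimiser_inflate_of_minAct_le`, `MinimalActionDictionary.sfClass_mono`), hence
`RegularSup … b c (k+1)`: the leaf at radius `ε` on `D` with the same letters. [folklore] -/
theorem leafH3sup_of_inflate_of_noBinding [Nonempty n] {L N : ℕ} {ε ε' b c : ℝ} (hεε' : ε ≤ ε')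
    {D D' : Set (Site d → Fin d → (Matrix n n ℂ)ˣ)} (hleaf : LeafH3sup d L N ε' b c D')
    (hNB : ∀ V ∈ D, ∀ (k : ℕ) (U : Site d → Fin d → (Matrix n n ℂ)ˣ), IsMinimiser d (sfClass d L N ε) L N (k + 1) V U →
      V ∈ D' ∧ (∃ U', IsMinimiser d (sfClass d L N ε') L N (k + 1) V U') ∧
        minAct d (sfClass d L N ε) L N (k + 1) V ≤ minAct d (sfClass d L N ε') L N (k + 1) V) :
    LeafH3sup d L N ε b c D := by
  intro V hV k U hU
  obtain ⟨hVD', ⟨U', hU'⟩, hle⟩ := hNB V hV k U hU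
  exact hleaf V hVD' k U (isMinimiser_inflate_of_minAct_le (sfClass_mono hεε') hU hU' hle)

/-! ## §4 The tight-window leaf, `stub_h7`'s shape and `stub_h7` at the record from Theorem 1 ∧ NO-BINDING -/

/-- **★ THE TIGHT-WINDOW LEAF (file 2's displayed `htight`, AP-N16-2 as a Lean statement) FROM [B11] THEOREM 1 AT THE TORUS INSTANCES AND NO-BINDING.**
Let `L ≥ 2`; `G`, `hGm`, `hG`, `C`, `hM`, `hT : ∀ k, Thm1At C (torusVP d L N G (k+1))` as in files 1–2; `a > 0`; and NO-BINDING on `]0, a]`: for every tight datum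
`V ∈ dom`, `V ∉ sfClass d L N (ε∕B₃) 0`, carrying a minimiser of run `k+1` over `sfClass d L N ε`, `A^{ε}_{k+1}(V) ≤ A^{(1+4B₃)ε}_{k+1}(V)` (DISPLAYED hypothesis; NOT in
print).  THEN `∃ Ct a′, 0 ≤ Ct ∧ 0 < a′ ∧ ∀ ε ∈ ]0,a′], LeafH3sup d L N ε (Ct·ε) (Ct·ε) {V ∈ dom | V ∉ sfClass d L N (ε∕B₃) 0 ∧ SmallField V (4ε)}`.  Proof: at
`ε′ = (1+4B₃)ε ≤ min(B₃a₁, 1∕28)` the datum is loose (`datum_mem_sfClass_of_isMinimiser`, `4ε ≤ ε′∕B₃`), Theorem 1 at `ε₁ = ε′∕B₃` gives (8) an `ε′`-minimiser and file 1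
§3 the leaf at `ε′` on loose data; §3 transfers it down to radius `ε`; letters `ε′ ≤ 16937ε′ = Ct·ε`. [cite: Balaban1985Variational, Thm 1 (8)–(10) p.279] -/
theorem tightLeaf_of_thm1At_torusVP_of_noBinding [Nonempty n] {L N : ℕ} (hL : 2 ≤ L)
    {G : (Site d → Fin d → (Matrix n n ℂ)ˣ) → Site d → ℕ → ℝ → ℝ → ℝ → Prop} (hGm : RadiiMono d G)
    (hG : ∀ (U : Site d → Fin d → (Matrix n n ℂ)ˣ) (x : Site d) (K : ℕ) (α₀ α₁ α₂ : ℝ), 2 ≤ K → G U x K α₀ α₁ α₂ →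
      ∃ (u : Site d → (Matrix n n ℂ)ˣ) (a : Site d → Fin d → Matrix n n ℂ),
        (∀ z, u z ∈ unitaryUnits (Matrix n n ℂ)) ∧
        (∀ (y : Site d) (τ : Fin d), l1 (y - x) ≤ 2 → ((gaugeAct u U y τ : (Matrix n n ℂ)ˣ) : Matrix n n ℂ) = exp (a y τ)) ∧
        (∀ (y : Site d) (τ : Fin d), l1 (y - x) ≤ 2 → ‖a y τ‖ ≤ α₀) ∧
        (∀ (y : Site d) (τ i : Fin d), l1 (y - x) ≤ 1 → ‖fd i (fun z => a z τ) y‖ ≤ α₁) ∧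
        (∀ (τ i l : Fin d), ‖fd i (fd l (fun z => a z τ)) x‖ ≤ α₂))
    (C : B11Thm1.Consts) (hM : ∀ e : ℝ, 0 < e → e ≤ C.a₁ → 7 / 2 ≤ C.Mfun e)
    (hT : ∀ k : ℕ, Thm1At C (torusVP d L N G (k + 1)))
    {dom : Set (Site d → Fin d → (Matrix n n ℂ)ˣ)} {a : ℝ} (ha : 0 < a)
    (hNB : ∀ ε : ℝ, 0 < ε → ε ≤ a → ∀ V ∈ dom, ∀ (k : ℕ) (U : Site d → Fin d → (Matrix n n ℂ)ˣ),
      IsMinimiser d (sfClass d L N ε) L N (k + 1) V U → V ∉ sfClass d L N (ε / C.B₃) 0 →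
        minAct d (sfClass d L N ε) L N (k + 1) V ≤ minAct d (sfClass d L N ((1 + 4 * C.B₃) * ε)) L N (k + 1) V) :
    ∃ Ct a' : ℝ, 0 ≤ Ct ∧ 0 < a' ∧ ∀ ε : ℝ, 0 < ε → ε ≤ a' →
      LeafH3sup d L N ε (Ct * ε) (Ct * ε) {V | V ∈ dom ∧ V ∉ sfClass d L N (ε / C.B₃) 0 ∧ SmallField V (4 * ε)} := by
  have hL1 : 1 ≤ L := by omega
  have hB₃ := C.B₃_pos
  have hκ0 : (0 : ℝ) < 1 + 4 * C.B₃ := by positivity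
  have hκ1 : (1 : ℝ) ≤ 1 + 4 * C.B₃ := by linarith
  have hC0 := C0_pos d
  have hc2 := c2'_pos d L hL1
  have hm0 : 0 < min (C.B₃ * C.a₁) (1 / 28) := lt_min (mul_pos hB₃ C.a₁_pos) (by norm_num)
  refine ⟨16937 * (1 + 4 * C.B₃), min a (min (min (C.B₃ * C.a₁) (1 / 28) / (1 + 4 * C.B₃)) (min (1 / (6 * C0 d)) (c2' d L / 4))),
    by positivity, lt_min ha (lt_min (div_pos hm0 hκ0) (lt_min (by positivity) (by positivity))), fun ε hε hεle => ?_⟩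
  have h1 : ε ≤ a := hεle.trans (min_le_left _ _)
  have h2 : ε ≤ min (C.B₃ * C.a₁) (1 / 28) / (1 + 4 * C.B₃) := hεle.trans ((min_le_right _ _).trans (min_le_left _ _))
  have h4 : ε ≤ 1 / (6 * C0 d) := hεle.trans ((min_le_right _ _).trans ((min_le_right _ _).trans (min_le_left _ _)))
  have h5 : ε ≤ c2' d L / 4 := hεle.trans ((min_le_right _ _).trans ((min_le_right _ _).trans (min_le_right _ _)))
  have hε3 : C0 d * (2 * ε) ≤ 1 / 3 := by
    have : ε * (6 * C0 d) ≤ 1 := by rwa [le_div_iff₀ (by positivity)] at h4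
    nlinarith
  have hε2 : 2 * (2 * ε) ≤ c2' d L := by linarith
  -- the inflated radius `ε′ = (1 + 4B₃) ε`
  have hε'0 : 0 < (1 + 4 * C.B₃) * ε := mul_pos hκ0 hε
  have hεε' : ε ≤ (1 + 4 * C.B₃) * ε := le_mul_of_one_le_left hε.le hκ1
  have hε'le : (1 + 4 * C.B₃) * ε ≤ min (C.B₃ * C.a₁) (1 / 28) := by rw [le_div_iff₀ hκ0] at h2; linarith
  have hloose := leafH3sup_loose_of_thm1At_torusVP hL1 hGm hG C hM hT hε'0 (hε'le.trans (min_le_left _ _))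
    (hε'le.trans (min_le_right _ _)) dom
  have key : LeafH3sup d L N ε ((1 + 4 * C.B₃) * ε) (16937 * ((1 + 4 * C.B₃) * ε))
      {V | V ∈ dom ∧ V ∉ sfClass d L N (ε / C.B₃) 0 ∧ SmallField V (4 * ε)} := by
    refine leafH3sup_of_inflate_of_noBinding hεε' hloose ?_
    rintro V ⟨hVdom, hVtight, -⟩ k U hU
    have hV4 : V ∈ sfClass d L N (4 * ε) 0 := datum_mem_sfClass_of_isMinimiser hL hε hε3 hε2 hU
    have h4le : 4 * ε ≤ (1 + 4 * C.B₃) * ε / C.B₃ := by rw [le_div_iff₀ hB₃]; nlinarith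
    have hV7 : V ∈ sfClass d L N ((1 + 4 * C.B₃) * ε / C.B₃) 0 := sfClass_mono h4le hV4
    have hε₁a : (1 + 4 * C.B₃) * ε / C.B₃ ≤ C.a₁ := by
      rw [div_le_iff₀ hB₃]; linarith [hε'le.trans (min_le_left _ _), mul_comm C.B₃ C.a₁]
    obtain ⟨⟨U', -, -, hU'⟩, -, -⟩ := hT k ((1 + 4 * C.B₃) * ε / C.B₃) (div_pos hε'0 hB₃) hε₁a V hV7
    have hBε : C.B₃ * ((1 + 4 * C.B₃) * ε / C.B₃) = (1 + 4 * C.B₃) * ε := by field_simp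
    have hU'min : IsMinimiser d (sfClass d L N ((1 + 4 * C.B₃) * ε)) L N (k + 1) V U' := by
      have h : IsMinimiser d (sfClass d L N (C.B₃ * ((1 + 4 * C.B₃) * ε / C.B₃))) L N (k + 1) V U' := hU'
      rwa [hBε] at h
    exact ⟨⟨hVdom, hV7⟩, ⟨U', hU'min⟩, hNB ε hε h1 V hVdom k U hU hVtight⟩
  refine leafH3sup_mono key ?_ (le_of_eq (by ring))
  nlinarith

/-- **★ THE SHAPE OF `stub_h7` ON ALL DATA FROM THEOREM 1 AT THE TORUS INSTANCES AND NO-BINDING** — file 2's `h7Shape_of_thm1At_torusVP_of_tightLeaf` with its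
tight-window leaf supplied by `tightLeaf_of_thm1At_torusVP_of_noBinding`: `∃ C′ ε₀, 0 ≤ C′ ∧ 0 < ε₀ ∧ ∀ ε ∈ ]0,ε₀], LeafH3sup d L N ε (C′ε) (C′ε) dom`.  Displayed
hypotheses: `hT` ([Balaban1985Variational] Thm 1 for leaf-06's instances) and NO-BINDING (NOT in print). [cite: Balaban1985Variational, Thm 1 (8)–(10) p.279] -/
theorem h7Shape_of_thm1At_torusVP_of_noBinding [Nonempty n] {L N : ℕ} (hL : 2 ≤ L)
    {G : (Site d → Fin d → (Matrix n n ℂ)ˣ) → Site d → ℕ → ℝ → ℝ → ℝ → Prop} (hGm : RadiiMono d G)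
    (hG : ∀ (U : Site d → Fin d → (Matrix n n ℂ)ˣ) (x : Site d) (K : ℕ) (α₀ α₁ α₂ : ℝ), 2 ≤ K → G U x K α₀ α₁ α₂ →
      ∃ (u : Site d → (Matrix n n ℂ)ˣ) (a : Site d → Fin d → Matrix n n ℂ),
        (∀ z, u z ∈ unitaryUnits (Matrix n n ℂ)) ∧
        (∀ (y : Site d) (τ : Fin d), l1 (y - x) ≤ 2 → ((gaugeAct u U y τ : (Matrix n n ℂ)ˣ) : Matrix n n ℂ) = exp (a y τ)) ∧
        (∀ (y : Site d) (τ : Fin d), l1 (y - x) ≤ 2 → ‖a y τ‖ ≤ α₀) ∧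
        (∀ (y : Site d) (τ i : Fin d), l1 (y - x) ≤ 1 → ‖fd i (fun z => a z τ) y‖ ≤ α₁) ∧
        (∀ (τ i l : Fin d), ‖fd i (fd l (fun z => a z τ)) x‖ ≤ α₂))
    (C : B11Thm1.Consts) (hM : ∀ e : ℝ, 0 < e → e ≤ C.a₁ → 7 / 2 ≤ C.Mfun e)
    (hT : ∀ k : ℕ, Thm1At C (torusVP d L N G (k + 1)))
    {dom : Set (Site d → Fin d → (Matrix n n ℂ)ˣ)} {a : ℝ} (ha : 0 < a)
    (hNB : ∀ ε : ℝ, 0 < ε → ε ≤ a → ∀ V ∈ dom, ∀ (k : ℕ) (U : Site d → Fin d → (Matrix n n ℂ)ˣ),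
      IsMinimiser d (sfClass d L N ε) L N (k + 1) V U → V ∉ sfClass d L N (ε / C.B₃) 0 →
        minAct d (sfClass d L N ε) L N (k + 1) V ≤ minAct d (sfClass d L N ((1 + 4 * C.B₃) * ε)) L N (k + 1) V) :
    ∃ C' ε₀ : ℝ, 0 ≤ C' ∧ 0 < ε₀ ∧ ∀ ε : ℝ, 0 < ε → ε ≤ ε₀ → LeafH3sup d L N ε (C' * ε) (C' * ε) dom :=
  h7Shape_of_thm1At_torusVP_of_tightLeaf hL hGm hG C hM hT (tightLeaf_of_thm1At_torusVP_of_noBinding hL hGm hG C hM hT ha hNB)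

/-- **★ `stub_h7`'S STATEMENT, LITERALLY, FROM [B11] THEOREM 1 AT THE RECORD'S TORUS INSTANCES ∧ NO-BINDING AT THE RECORD** (d = 4, `L = F.L`, period
`ne3NperOfRecord₁₁ F 0 0`, data `ne3DomOfRecord₁₁ F N 0 0`; dag-n16-e's evidence #6 `N16DischargeTest.stub_h7`).  Compared with file 2's
`h7_at_record_of_thm1At_of_tightLeaf` the tight-window leaf (AP-N16-2, regularity-type) is replaced by NO-BINDING-at-record (value-type).  Nothing of Bałaban is asserted.
[cite: Balaban1985Variational, Thm 1 (8)–(10) p.279] -/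
theorem h7_at_record_of_thm1At_of_noBinding {N : ℕ} [NeZero N] (F : T4Family)
    {G : (Site 4 → Fin 4 → (MatA N)ˣ) → Site 4 → ℕ → ℝ → ℝ → ℝ → Prop} (hGm : RadiiMono 4 G)
    (hG : ∀ (U : Site 4 → Fin 4 → (MatA N)ˣ) (x : Site 4) (K : ℕ) (α₀ α₁ α₂ : ℝ), 2 ≤ K → G U x K α₀ α₁ α₂ →
      ∃ (u : Site 4 → (MatA N)ˣ) (a : Site 4 → Fin 4 → MatA N),
        (∀ z, u z ∈ unitaryUnits (MatA N)) ∧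
        (∀ (y : Site 4) (τ : Fin 4), l1 (y - x) ≤ 2 → ((gaugeAct u U y τ : (MatA N)ˣ) : MatA N) = exp (a y τ)) ∧
        (∀ (y : Site 4) (τ : Fin 4), l1 (y - x) ≤ 2 → ‖a y τ‖ ≤ α₀) ∧
        (∀ (y : Site 4) (τ i : Fin 4), l1 (y - x) ≤ 1 → ‖fd i (fun z => a z τ) y‖ ≤ α₁) ∧
        (∀ (τ i l : Fin 4), ‖fd i (fd l (fun z => a z τ)) x‖ ≤ α₂))
    (C : B11Thm1.Consts) (hM : ∀ e : ℝ, 0 < e → e ≤ C.a₁ → 7 / 2 ≤ C.Mfun e)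
    (hT : ∀ k : ℕ, Thm1At C (torusVP 4 F.L (ne3NperOfRecord₁₁ F 0 0) G (k + 1)))
    {a : ℝ} (ha : 0 < a)
    (hNB : ∀ ε : ℝ, 0 < ε → ε ≤ a → ∀ V ∈ ne3DomOfRecord₁₁ F N 0 0, ∀ (k : ℕ) (U : Site 4 → Fin 4 → (MatA N)ˣ),
      IsMinimiser 4 (sfClass 4 F.L (ne3NperOfRecord₁₁ F 0 0) ε) F.L (ne3NperOfRecord₁₁ F 0 0) (k + 1) V U →
        V ∉ sfClass 4 F.L (ne3NperOfRecord₁₁ F 0 0) (ε / C.B₃) 0 →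
        minAct 4 (sfClass 4 F.L (ne3NperOfRecord₁₁ F 0 0) ε) F.L (ne3NperOfRecord₁₁ F 0 0) (k + 1) V ≤
          minAct 4 (sfClass 4 F.L (ne3NperOfRecord₁₁ F 0 0) ((1 + 4 * C.B₃) * ε)) F.L (ne3NperOfRecord₁₁ F 0 0) (k + 1) V) :
    ∃ C' ε₀ : ℝ, 0 ≤ C' ∧ 0 < ε₀ ∧ ∀ ε : ℝ, 0 < ε → ε ≤ ε₀ →
      LeafH3sup 4 F.L (ne3NperOfRecord₁₁ F 0 0) ε (C' * ε) (C' * ε) (ne3DomOfRecord₁₁ F N 0 0) :=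
  h7Shape_of_thm1At_torusVP_of_noBinding F.hL.2 hGm hG C hM hT ha hNB

/-! ## §5 The dichotomy at every datum, from Theorem 1 alone -/

/-- **INFLATION NEVER RAISES THE MINIMAL ACTION** (from Theorem 1's (8) at the inflated radius): under files 1–2's hypotheses and `(1+4B₃)ε ≤ min(B₃a₁, 1∕28)`,
`C₀·2ε ≤ ⅓`, `4ε ≤ c₂′`, at every datum carrying an `ε`-minimiser of run `k+1`, `A^{(1+4B₃)ε}_{k+1}(V) ≤ A^{ε}_{k+1}(V)`.  So NO-BINDING is the EQUALITY of the two
minimal values. [cite: Balaban1985Variational, Thm 1 (8) p.279] -/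
theorem minAct_inflate_le_of_thm1At_torusVP [Nonempty n] {L N : ℕ} (hL : 2 ≤ L)
    {G : (Site d → Fin d → (Matrix n n ℂ)ˣ) → Site d → ℕ → ℝ → ℝ → ℝ → Prop}
    (C : B11Thm1.Consts) (hT : ∀ k : ℕ, Thm1At C (torusVP d L N G (k + 1)))
    {ε : ℝ} (hε : 0 < ε) (hεa : (1 + 4 * C.B₃) * ε ≤ C.B₃ * C.a₁) (hε3 : C0 d * (2 * ε) ≤ 1 / 3) (hε2 : 2 * (2 * ε) ≤ c2' d L)
    {k : ℕ} {V U : Site d → Fin d → (Matrix n n ℂ)ˣ} (hU : IsMinimiser d (sfClass d L N ε) L N (k + 1) V U) :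
    (∃ U', IsMinimiser d (sfClass d L N ((1 + 4 * C.B₃) * ε)) L N (k + 1) V U') ∧
      minAct d (sfClass d L N ((1 + 4 * C.B₃) * ε)) L N (k + 1) V ≤ minAct d (sfClass d L N ε) L N (k + 1) V := by
  have hB₃ := C.B₃_pos
  have hκ0 : (0 : ℝ) < 1 + 4 * C.B₃ := by positivity
  have hκ1 : (1 : ℝ) ≤ 1 + 4 * C.B₃ := by linarith
  have hε'0 : 0 < (1 + 4 * C.B₃) * ε := mul_pos hκ0 hε
  have hεε' : ε ≤ (1 + 4 * C.B₃) * ε := le_mul_of_one_le_left hε.le hκ1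
  have hV4 : V ∈ sfClass d L N (4 * ε) 0 := datum_mem_sfClass_of_isMinimiser hL hε hε3 hε2 hU
  have h4le : 4 * ε ≤ (1 + 4 * C.B₃) * ε / C.B₃ := by rw [le_div_iff₀ hB₃]; nlinarith
  have hV7 : V ∈ sfClass d L N ((1 + 4 * C.B₃) * ε / C.B₃) 0 := sfClass_mono h4le hV4
  have hε₁a : (1 + 4 * C.B₃) * ε / C.B₃ ≤ C.a₁ := by rw [div_le_iff₀ hB₃]; linarith [mul_comm C.B₃ C.a₁]
  obtain ⟨⟨U', -, -, hU'⟩, -, -⟩ := hT k ((1 + 4 * C.B₃) * ε / C.B₃) (div_pos hε'0 hB₃) hε₁a V hV7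
  have hBε : C.B₃ * ((1 + 4 * C.B₃) * ε / C.B₃) = (1 + 4 * C.B₃) * ε := by field_simp
  have hU'min : IsMinimiser d (sfClass d L N ((1 + 4 * C.B₃) * ε)) L N (k + 1) V U' := by
    have h : IsMinimiser d (sfClass d L N (C.B₃ * ((1 + 4 * C.B₃) * ε / C.B₃))) L N (k + 1) V U' := hU'
    rwa [hBε] at h
  exact ⟨⟨U', hU'min⟩, minAct_inflate_le (sfClass_mono hεε') hU hU'min⟩

/-- **★ THE DICHOTOMY FROM [B11] THEOREM 1 AT THE TORUS INSTANCES ALONE.**  Under files 1–2's hypotheses (`L ≥ 2`, `G`, `hGm`, `hG`, `C`, `hM`, `hT`) and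
`(1+4B₃)ε ≤ min(B₃a₁, 1∕28)`, `C₀·2ε ≤ ⅓`, `4ε ≤ c₂′`: at EVERY datum `V` (loose or tight) and every minimiser `U` of run `k+1` over `sfClass d L N ε`, EITHER `U` is
(9)–(10)-regular with the linear letters of the inflated radius, `RegularSup d L N ((1+4B₃)ε) (16937(1+4B₃)ε) (k+1) U` (case `A^{ε} = A^{(1+4B₃)ε}`: `U` is an
inflated-class minimiser, its datum is loose there, file 1 §3), OR `A^{(1+4B₃)ε}_{k+1}(V) < A^{ε}_{k+1}(V)` (the radius-`ε` plaquette constraint binds in energy; the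
`ε`-minimisers are NOT inflated-class minimisers and Theorem 1 says nothing about them).  Nothing of Bałaban is asserted (`hT` displayed).
[cite: Balaban1985Variational, Thm 1 (8)–(10) p.279] -/
theorem regularSup_or_minAct_lt_of_thm1At_torusVP [Nonempty n] {L N : ℕ} (hL : 2 ≤ L)
    {G : (Site d → Fin d → (Matrix n n ℂ)ˣ) → Site d → ℕ → ℝ → ℝ → ℝ → Prop} (hGm : RadiiMono d G)
    (hG : ∀ (U : Site d → Fin d → (Matrix n n ℂ)ˣ) (x : Site d) (K : ℕ) (α₀ α₁ α₂ : ℝ), 2 ≤ K → G U x K α₀ α₁ α₂ →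
      ∃ (u : Site d → (Matrix n n ℂ)ˣ) (a : Site d → Fin d → Matrix n n ℂ),
        (∀ z, u z ∈ unitaryUnits (Matrix n n ℂ)) ∧
        (∀ (y : Site d) (τ : Fin d), l1 (y - x) ≤ 2 → ((gaugeAct u U y τ : (Matrix n n ℂ)ˣ) : Matrix n n ℂ) = exp (a y τ)) ∧
        (∀ (y : Site d) (τ : Fin d), l1 (y - x) ≤ 2 → ‖a y τ‖ ≤ α₀) ∧
        (∀ (y : Site d) (τ i : Fin d), l1 (y - x) ≤ 1 → ‖fd i (fun z => a z τ) y‖ ≤ α₁) ∧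
        (∀ (τ i l : Fin d), ‖fd i (fd l (fun z => a z τ)) x‖ ≤ α₂))
    (C : B11Thm1.Consts) (hM : ∀ e : ℝ, 0 < e → e ≤ C.a₁ → 7 / 2 ≤ C.Mfun e)
    (hT : ∀ k : ℕ, Thm1At C (torusVP d L N G (k + 1)))
    {ε : ℝ} (hε : 0 < ε) (hεa : (1 + 4 * C.B₃) * ε ≤ min (C.B₃ * C.a₁) (1 / 28)) (hε3 : C0 d * (2 * ε) ≤ 1 / 3)
    (hε2 : 2 * (2 * ε) ≤ c2' d L) {k : ℕ} {V U : Site d → Fin d → (Matrix n n ℂ)ˣ}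
    (hU : IsMinimiser d (sfClass d L N ε) L N (k + 1) V U) :
    RegularSup d L N ((1 + 4 * C.B₃) * ε) (16937 * ((1 + 4 * C.B₃) * ε)) (k + 1) U ∨
      minAct d (sfClass d L N ((1 + 4 * C.B₃) * ε)) L N (k + 1) V < minAct d (sfClass d L N ε) L N (k + 1) V := by
  have hL1 : 1 ≤ L := by omega
  have hB₃ := C.B₃_pos
  have hκ0 : (0 : ℝ) < 1 + 4 * C.B₃ := by positivity
  have hκ1 : (1 : ℝ) ≤ 1 + 4 * C.B₃ := by linarith
  have hε'0 : 0 < (1 + 4 * C.B₃) * ε := mul_pos hκ0 hε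
  have hεε' : ε ≤ (1 + 4 * C.B₃) * ε := le_mul_of_one_le_left hε.le hκ1
  obtain ⟨⟨U', hU'⟩, -⟩ := minAct_inflate_le_of_thm1At_torusVP hL C hT hε (hεa.trans (min_le_left _ _)) hε3 hε2 hU
  by_cases hle : minAct d (sfClass d L N ε) L N (k + 1) V ≤ minAct d (sfClass d L N ((1 + 4 * C.B₃) * ε)) L N (k + 1) V
  · left
    have hV4 : V ∈ sfClass d L N (4 * ε) 0 := datum_mem_sfClass_of_isMinimiser hL hε hε3 hε2 hU
    have h4le : 4 * ε ≤ (1 + 4 * C.B₃) * ε / C.B₃ := by rw [le_div_iff₀ hB₃]; nlinarith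
    have hV7 : V ∈ sfClass d L N ((1 + 4 * C.B₃) * ε / C.B₃) 0 := sfClass_mono h4le hV4
    have hloose := leafH3sup_loose_of_thm1At_torusVP hL1 hGm hG C hM hT hε'0 (hεa.trans (min_le_left _ _))
      (hεa.trans (min_le_right _ _)) Set.univ
    exact hloose V ⟨Set.mem_univ V, hV7⟩ k U (isMinimiser_inflate_of_minAct_le (sfClass_mono hεε') hU hU' hle)
  · right
    exact lt_of_not_ge hle

/-- **THE DICHOTOMY, ESCAPE FORM**: at every datum carrying an `ε`-minimiser `U` of run `k+1`, EITHER `U` is (9)–(10)-regular with the inflated linear letters, OR print's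
minimal configurations at the inflated radius ALL ESCAPE the tree's ball — an `(1+4B₃)ε`-minimiser exists ((8) at `ε₁ = (1+4B₃)ε∕B₃`) and every one of them has a
plaquette with `|U′(∂p) − 1| > ε·L^{−2(k+1)}` (`U′ ∉ sfClass d L N ε (k+1)`): the tree's minimisers and print's are then DIFFERENT objects.  From `hT` alone; nothing
of Bałaban asserted. [cite: Balaban1985Variational, Thm 1 (8)–(10) p.279] -/
theorem regularSup_or_escape_of_thm1At_torusVP [Nonempty n] {L N : ℕ} (hL : 2 ≤ L)
    {G : (Site d → Fin d → (Matrix n n ℂ)ˣ) → Site d → ℕ → ℝ → ℝ → ℝ → Prop} (hGm : RadiiMono d G)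
    (hG : ∀ (U : Site d → Fin d → (Matrix n n ℂ)ˣ) (x : Site d) (K : ℕ) (α₀ α₁ α₂ : ℝ), 2 ≤ K → G U x K α₀ α₁ α₂ →
      ∃ (u : Site d → (Matrix n n ℂ)ˣ) (a : Site d → Fin d → Matrix n n ℂ),
        (∀ z, u z ∈ unitaryUnits (Matrix n n ℂ)) ∧
        (∀ (y : Site d) (τ : Fin d), l1 (y - x) ≤ 2 → ((gaugeAct u U y τ : (Matrix n n ℂ)ˣ) : Matrix n n ℂ) = exp (a y τ)) ∧
        (∀ (y : Site d) (τ : Fin d), l1 (y - x) ≤ 2 → ‖a y τ‖ ≤ α₀) ∧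
        (∀ (y : Site d) (τ i : Fin d), l1 (y - x) ≤ 1 → ‖fd i (fun z => a z τ) y‖ ≤ α₁) ∧
        (∀ (τ i l : Fin d), ‖fd i (fd l (fun z => a z τ)) x‖ ≤ α₂))
    (C : B11Thm1.Consts) (hM : ∀ e : ℝ, 0 < e → e ≤ C.a₁ → 7 / 2 ≤ C.Mfun e)
    (hT : ∀ k : ℕ, Thm1At C (torusVP d L N G (k + 1)))
    {ε : ℝ} (hε : 0 < ε) (hεa : (1 + 4 * C.B₃) * ε ≤ min (C.B₃ * C.a₁) (1 / 28)) (hε3 : C0 d * (2 * ε) ≤ 1 / 3)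
    (hε2 : 2 * (2 * ε) ≤ c2' d L) {k : ℕ} {V U : Site d → Fin d → (Matrix n n ℂ)ˣ}
    (hU : IsMinimiser d (sfClass d L N ε) L N (k + 1) V U) :
    RegularSup d L N ((1 + 4 * C.B₃) * ε) (16937 * ((1 + 4 * C.B₃) * ε)) (k + 1) U ∨
      ((∃ U', IsMinimiser d (sfClass d L N ((1 + 4 * C.B₃) * ε)) L N (k + 1) V U') ∧
        ∀ U', IsMinimiser d (sfClass d L N ((1 + 4 * C.B₃) * ε)) L N (k + 1) V U' → U' ∉ sfClass d L N ε (k + 1)) := by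
  have hκ1 : (1 : ℝ) ≤ 1 + 4 * C.B₃ := by linarith [C.B₃_pos]
  have hεε' : ε ≤ (1 + 4 * C.B₃) * ε := le_mul_of_one_le_left hε.le hκ1
  rcases regularSup_or_minAct_lt_of_thm1At_torusVP hL hGm hG C hM hT hε hεa hε3 hε2 hU with hreg | hlt
  · exact Or.inl hreg
  · refine Or.inr ⟨(minAct_inflate_le_of_thm1At_torusVP hL C hT hε (hεa.trans (min_le_left _ _)) hε3 hε2 hU).1, fun U' hU' => ?_⟩
    exact not_mem_of_minAct_lt (sfClass_mono hεε') hU' hlt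

end

end Summit.QuantumFields.YangMills.BalabanUVNodes.N16H7NoBinding
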